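import Literature.MathematicalPhysics.QuantumFieldTheory.Balaban1983to89.B8Prop5JoinHFP
import Literature.MathematicalPhysics.QuantumFieldTheory.Balaban1983to89.B8SectEKLevelInLambda

/-!
# `Balaban1983to89.B8Prop5JoinSectE` — T. Bałaban, *Spaces of regular gauge field configurations on a lattice and gauge fixing conditions*,
# Commun. Math. Phys. **99** (1985) 75–102 [Balaban1985RegularSpaces] ("B8"), Sect. D–E pp. 92–97: THE SECT. E CORRECTION OF PROPOSITION 5'S
# CONTRACTION INSTANTIATED («JOIN-C») — the eight `H_c` binders and the (1.79) input `h179` of `B8Prop5JoinHFP.hFP_kLevel_of179` (JOIN-B,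
# p430157) DISCHARGED from `pub-ymgap-dag-n05-b`'s Sect. E at `k` levels (`B8Eq1117KLevel`, `B8DprimeKLevelLipschitz`) BY NAME, with
# `H_c λ := −i·H′D′(u₁⁻¹, −iλ)` on the inverse pair `(e^{−iλ}, u₁⁻¹)` of the (a″) ruling

statement-level skeleton of published theorems with citation tags; proofs where landed; nothing here is a claim about the
Yang–Mills mass gap

PDF held: `paper:balaban1985-cmp99-regular-spaces-gauge-fixing` (journal page = PDF page + 74); pp. 92–97.  [3] = [Balaban1985Averaging]
(Prop. 10, (166)–(167) p. 44, (208), (213)–(214) p. 50); [4] = [Balaban1985BackgroundPropagators] ((1.91)–(1.92) of B8).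

WHY THIS FILE (cell `pub-ymgap`, HUMAN RULING D-0062; dag-lead REBALANCE №41-c, INBOX l.11488, 2026-08-26; seat `pub-ymgap-dag-n19-b` g3 — the named
remainder of REBALANCE №41-b after JOIN-A `B8Prop5GaugeParamKLevel` and JOIN-B `B8Prop5JoinHFP`).  JOIN-B left the Sect. E correction `H_c` of
`λ′ = λ + H_cλ` ((1.113)) as a LETTER with eight displayed binders (sizes `h₀ h₁ h₂`, moduli `l₀ l₁ l₂`, reality, support) and Sect. E's (1.114) in
its printed use (`h179`).  Here `H_c` is INSTANTIATED: by the ORDER RULING (a″) of `pub-ymgap-dag-n05-a` (INBOX l.11309: Sect. E / `C′` run on the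
INVERSE PAIR `(e^{−iλ}, u₁⁻¹)`, no conjugation; n05-a's by-name check answered: `Qnl L U₀ …`, `Cnl L U₀ u₁⁻¹ …`, `QprimeIter (zdBlocking d L)
(bgT L U₀) …` are all read at the SAME background `U₀` as `lamSubK η U₀ …` — no frame change under inversion), Sect. E's variable is `λ_E := −iλ`
(`u′ = e^{λ_E} = (e^{iλ})⁻¹`, `B7Prop1Explicit.val_inv_expUnit`), its gauge transformation is `u₁,E := u₁⁻¹`, and `H_cλ := −i·H′D′(u₁⁻¹, −iλ)`, so that
`e^{λ_E − H′D′} = (e^{iλ′})⁻¹` pointwise.  INPUTS BY NAME: `pub-ymgap-dag-n04-b`'s `B8SectEKLevelInLambda.exists_Dprime_kLevel_inv_of_axial`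
(D′ + bounds + (1.117) + (1.114) FOR THE INVERSE PAIR with every Sect. E hypothesis stated AT `u₁` — the datum's own (1.34) `InAx`, (1.29) `Restr129`,
(1.69), unitarity of `U₁ = e^B`, the plaquette regularity of `U₁U₀` — over n05-b's `B8Eq1117KLevel` tower-local frame; p433658) and
`.Dprime_lipschitz_kLevel_inv_of_axial`; n05-b's `B8Eq1117KLevel.dom120_of_119_tower`, `B8DprimeKLevelLipschitz.smallness_prod`; g2's
`B8LambdaSpaceKLevel.norm_cjDiff_lamOf_le` / `weight_mul_norm_covDerivFwd_le`
((1.102) ball ⇒ (1.119) on towers), `B8Eq151V2Divergence.{eta_smul_covDerivFwd, covDerivFwd_smul}`, `B8Eq146AExpansion.covDeriv_smul`,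
`B8Eq1123Concrete.cj_smul_complex`, `B7Eq78Linearization.QprimeIter_smul`, `B8SectEKLevelDomainSeq.mem_of_inBox_tower_of_domainSeq`,
`B7Prop2Explicit.avgClosed_unitaryUnits`; and JOIN-B `B8Prop5JoinHFP.hFP_kLevel_of179` itself.

WHAT THIS FILE PROVES (kernel, 0 sorry, theorems only; `𝔸` a nontrivial C⋆-algebra, `U₀` unitary):
* §0 bookkeeping (`‖(−i)a‖ = ‖a‖`, `((−i)a)* = i·a*`, `Δ(cf) = cΔf`, weighted gradient ⇒ tower modulus `cjDiff_le_of_weighted`);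
* §1 `ball_sub_119`, `ball_diff_modulus` — the ¼α₄-ball of (1.102) lies in Sect. E's half-size set (1.119) for `λ_E = −iλ`, tower by tower, and the
  difference modulus of `λ_E,s − λ_E,t` is `‖s − t‖`; `hEbT_of_domainSeq` — tower bonds are bonds of `Eb j` under the admissibility record (1.3)/(1.4);
* §2 **`sectE_exists`** (D′(u₁⁻¹, −iλ_s): ball, size `C2p(α₃ + α₄)α₄`, zero off `𝔅_k`, (1.117), (1.114)), **`sectE_lipschitz`** (`‖X_s − X_t‖ ≤
  4C2p(α₃ + 2α₄)‖s − t‖`; at `s = t` «exactly one solution»), **`sectE_real`** (for Hermitian `λ_s`, `X(j, y)* = −X(j, y)`, by uniqueness from the two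
  displayed `U(N)`-covariance laws below);
* §3 **`cond179_of_eq114`** — (1.114) for the inverse pair + the LINEAR constraint `Q′λ_s = 0` ⇒ (1.79) `Q′(u₁⁻¹, (e^{iλ′})⁻¹) = 0` on `𝔅_k`;
* §4 **`exists_Dprime_map`** (the map `λ ↦ D′(u₁⁻¹, −iλ)` chosen once on the ball: solution, size, (1.114), Lipschitz, reality) and
  **`hFP_kLevel_of_sectE`** — JOIN-B's conclusion (the `hFP` binder of `B8Prop5KLevelLetters.hP5_step_of_HFP` / `B8LeafModelZdOfHFP.SockHFP`:
  `λ′` Hermitian, `= 0` off `Ω₀`, (1.108), the multiplier form of the Landau equation on `Ω₀`, (1.29) for `u₁·e^{iλ′}`) with NO free `H_c`: sizes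
  `h₀ = h₁ = B′₀C2p(α₃ + α₄)α₄`, `h₂ = B′₂C2p(α₃ + α₄)α₄`, moduli `l₀ = l₁ = 4B′₀C2p(α₃ + 2α₄)`, `l₂ = 4B′₂C2p(α₃ + 2α₄)` (`α₃ = 40d·c_B`).

DISPLAYED HYPOTHESES of `hFP_kLevel_of_sectE`, each named for its source: the letters `g Δ q qs Aw c` of [4] with `g_left`/`g_right`/`c_right` and
the concrete readings `hΔ`/`hqs` (JOIN-B) + `hq` (`q = Q′_j(U₀)` on `Λ_j`); the letter `H′` of [4] (1.92) as a `ℂ`-linear map `XSpace d k 𝔸 → (ℤᵈ → 𝔸)`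
with `hH0` (sup, `B′₀`), `hH1` (`Eb`-weighted gradient, `B′₀`), `hH2` (weighted Laplacian in `Bd2` form, `B′₂`), Dirichlet range `hHsupp`, `Q′H′ = I` on
`𝔅_k` (`hQH`, (1.91)) and the covariance `hHequiv` (`H′(−X*) = −(H′X)*`); the covariance `hCequiv` of [3]'s remainder (`C′_j(u₁⁻¹, −μ*)(y) =
−(C′_j(u₁⁻¹, μ)(y))*` on the (1.120)-set of the tower — tacit in print, where all averages are `U(N)`-valued, [3] (22)–(23)); n05-b's tower-local Sect. E
regime in n04-b's AT-`u₁` form ((1.33) `h33`, (1.69) `h69`, unitarity `hBu` and plaquette regularity `hP` of `U₁U₀`, (1.34) `InAx` and (1.29) `Restr129`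
FOR `u₁` ITSELF, the eight `j`-free windows at `2α₄`, `2048·d·c_B ≤ 1`, «α₃ + α₄ ≦ 1/(4B′₀C′₂)» `hsm`); tower bonds in
`Eb j` (`hEbT`); (1.101)/(1.98)R, Dirichlet range and reality of `G′`, `R`; the datum `A`; JOIN-B's windows at the Sect. E sizes (`ha₁'`, `hb₁'`, `hθ`,
(1.103) `h103`, (1.106) `h106`, with `hE hE₂ lE lE₂` named by defining equations); [3] Prop. 10's domain/(167) inputs for the inverse pair
`((e^{iλ′})⁻¹, u₁⁻¹)` at EVERY `λ′` of sup `≤ ¼α₄ + h₀` and `Eb`-weighted gradient `≤ ¼α₄ + h₁` (`hdom`, `h167`); (1.29) for `u₁⁻¹`; `β`-smallness.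

HONEST SCOPE.  Assembly over landed modules; nothing of [4] ((1.91)–(1.92), (1.98)–(1.101)), of [3] Prop. 10, or of Sect. E beyond
n05-b's results is proved here; `hHequiv`/`hCequiv` are DISPLAYED covariance laws (the reality of `D′` is DERIVED from them by uniqueness, not assumed);
the constants are this lineage's (sufficient, not optimal).  Count-neutral; N05 NOT discharged; nothing continuum / ℝ⁴ / OS / mass-gap / Clay.
Unit `pub-ymgap-dag-n19-b` (g3), 2026-08-26.  Tree API by name only, nothing restated.
-/

noncomputable section

open NormedSpace Metric Set Filter Topology
open Complex (I)

namespace Literature.MathematicalPhysics.QuantumFieldTheory.Balaban1983to89.B8Prop5JoinSectE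

open B7Prop1Explicit (e U1 expUnit val_inv_expUnit)
open B7Prop2Explicit (unitaryUnits mem_unitaryUnits unitaryUnits_le_U1 avgClosed_unitaryUnits AvgClosed C0 c2')
open B7Prop1Local (InBox pdevOn)
open B7Prop3Flat (expCfg c3)
open B7Eq78Linearization (conjR zdBlocking QprimeIter QprimeIter_smul)
open B7Eq170Flat (cj cj_apply)
open B7Prop10General (C6 C4G)
open B7Prop10Flat (one_le_C5 C4'_nonneg C5'_nonneg)
open B7Prop9Flat (C5')
open B7Eq214General (Cgen)
open B8Ineq130 (tlo thi)
open B7Eq84Concrete (glev)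
open B7Eq92Concrete (mgauge)
open B8Eq119TwistedAxial (bgT InAx Restr129)
open B8Eq178Averages (util178 Qnl Cond179)
open B8Eq1123Concrete (Cnl cj_smul_complex)
open B8Ineq125Concrete (C2p C2p_nonneg)
open B8Eq1117Concrete (XSpace)
open B8Eq1117KLevel (dom120_of_119_tower)
open B8DprimeKLevelLipschitz (smallness_prod)
open B8SectEKLevelInLambda (exists_Dprime_kLevel_inv_of_axial Dprime_lipschitz_kLevel_inv_of_axial)
open B8Ineq132 (covDerivFwd covDeriv norm_conjR)
open B8Eq151V2Divergence (eta_smul_covDerivFwd covDerivFwd_smul)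
open B8Eq146AExpansion (covDeriv_smul)
open B8Eq138LandauZd (covLap covDivB QT)
open B8Eq182Proof (gAd)
open B8Eq184Proof (gaugeExp)
open B8Eq188Proof (frakF3)
open B7Eq167Flat (Cond167)
open B8LambdaSpaceKLevel (wt wt_pos wt_nonneg lamSubK lamOf lamOf_sub norm_lamOf_le weight_mul_norm_covDerivFwd_le norm_cjDiff_lamOf_le
  norm_le_iff norm_sub_le_iff covDerivFwd_sub')
open B8Prop5ContractionKLevel (Bd2 Mc Kc)
open B8Prop5KLevelLetters (covLap_sub)
open B8Prop5JoinHFP (hFP_kLevel_of179)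

-- `Site` alone could resolve to the torus sites of `Setup.lean`; re-export the `ℤ^d` sites of `B7Prop1Explicit`.
export B7Prop1Explicit (Site)

variable {d : ℕ} {𝔸 : Type*} [CStarAlgebra 𝔸] [Nontrivial 𝔸]

/-! ## §0 Bookkeeping: the scalar `−i`, weighted gradients in Sect. E's currency, `Δ(cf) = cΔf` -/

section Bookkeeping

omit [Nontrivial 𝔸] in
/-- `‖(−i)·a‖ = ‖a‖`. [folklore] -/
private theorem norm_negI_smul (a : 𝔸) : ‖(-I) • a‖ = ‖a‖ := by
  rw [norm_smul, norm_neg, Complex.norm_I, one_mul]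

omit [Nontrivial 𝔸] in
/-- `i·((−i)·a) = a` and `(−i)·(i·a) = a`. [folklore] -/
private theorem I_smul_negI_smul (a : 𝔸) : I • ((-I) • a) = a ∧ (-I) • (I • a) = a := by
  constructor <;> rw [smul_smul] <;> simp [Complex.I_mul_I]

omit [Nontrivial 𝔸] in
/-- `((−i)·a)* = i·a*` in a C⋆-algebra. [folklore] -/
private theorem star_negI_smul (a : 𝔸) : star ((-I) • a) = I • star a := by
  rw [star_smul, star_neg, Complex.star_def, Complex.conj_I, neg_neg]

omit [Nontrivial 𝔸] in
/-- `(−i)·a` is Hermitian when `a* = −a`. [folklore] -/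
private theorem isSelfAdjoint_negI_smul_of_skew {a : 𝔸} (ha : star a = -a) : IsSelfAdjoint ((-I) • a) := by
  rw [IsSelfAdjoint, star_negI_smul, ha, smul_neg, ← neg_smul]

omit [Nontrivial 𝔸] in
/-- `((−i)·a)* = −((−i)·a)` when `a` is Hermitian: `−iλ` is skew for Hermitian `λ`. [folklore] -/
private theorem star_negI_smul_of_sa {a : 𝔸} (ha : IsSelfAdjoint a) : star ((-I) • a) = -((-I) • a) := by
  rw [star_negI_smul, ha.star_eq, neg_smul, neg_neg]

variable {L k : ℕ} {η : ℝ} {U₀ : Site d → Fin d → 𝔸ˣ}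

omit [Nontrivial 𝔸] in
/-- **Weighted gradient ⇒ Sect. E's tower modulus**: `(Lʲη)‖(D^η_{U₀,κ}f)(x)‖ ≤ a` gives `‖R(U₀(b))f(b₊) − f(b₋)‖ ≤ a·L^{−j}` (`η > 0`
cancels; `L ≥ 1`). [cite: Balaban1985RegularSpaces, (1.1) p.76, (1.102) p.93, (1.119) p.96] -/
theorem cjDiff_le_of_weighted (hL : 1 ≤ L) (hη : 0 < η) {j : ℕ} {f : Site d → 𝔸} {x : Site d} {κ : Fin d} {a : ℝ}
    (h : wt L η j * ‖covDerivFwd η U₀ κ f x‖ ≤ a) : ‖cj (U₀ x κ) (f (x + e κ)) - f x‖ ≤ a * ((L : ℝ) ^ j)⁻¹ := by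
  have hLj : (0 : ℝ) < (L : ℝ) ^ j := by
    have : (0 : ℝ) < L := by exact_mod_cast hL
    positivity
  rw [cj_apply, show (U₀ x κ : 𝔸) * f (x + e κ) * ((U₀ x κ)⁻¹ : 𝔸ˣ) = conjR (U₀ x κ) (f (x + e κ)) from rfl,
    ← eta_smul_covDerivFwd hη.ne' U₀ κ f x, norm_smul, Real.norm_of_nonneg hη.le, le_mul_inv_iff₀ hLj]
  calc η * ‖covDerivFwd η U₀ κ f x‖ * (L : ℝ) ^ j = wt L η j * ‖covDerivFwd η U₀ κ f x‖ := by unfold wt; ring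
    _ ≤ a := h

omit [Nontrivial 𝔸] in
/-- `Δ^η_{U₀}(c·f) = c·Δ^η_{U₀}f` (complex scalar). [cite: Balaban1985BackgroundPropagators, (3.23) p.394] (elementary API; our proof) -/
theorem covLap_smul (η : ℝ) (U₀ : Site d → Fin d → 𝔸ˣ) (c : ℂ) (f : Site d → 𝔸) (x : Site d) :
    covLap η U₀ (c • f) x = c • covLap η U₀ f x := by
  show (∑ μ, covDeriv η U₀ μ (covDerivFwd η U₀ μ (c • f)) x) = c • ∑ μ, covDeriv η U₀ μ (covDerivFwd η U₀ μ f) x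
  rw [Finset.smul_sum]
  refine Finset.sum_congr rfl fun μ _ => ?_
  have h : covDerivFwd η U₀ μ (c • f) = c • covDerivFwd η U₀ μ f := funext fun y => covDerivFwd_smul η U₀ μ c f y
  rw [h, covDeriv_smul]

end Bookkeeping

/-! ## §1 The ¼α₄-ball of (1.102) lies in Sect. E's set (1.119) for `λ_E = −iλ`, tower by tower -/

section Ball

variable {L k : ℕ} {η : ℝ} {Λs : ℕ → Set (Site d)} {Eb : ℕ → Set (Site d × Fin d)} {U₀ : Site d → Fin d → 𝔸ˣ}

omit [Nontrivial 𝔸] in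
/-- **(1.102)-ball ⇒ (1.119) on the towers, for `λ_E := −iλ`** (the (a″) convention of the join, `pub-ymgap-dag-n05-a` RULING INBOX l.11309:
Sect. E is run on the inverse pair `(e^{−iλ}, u₁⁻¹)` at the same background `U₀`): if `‖s‖ ≤ ¼α₄` and every bond of the tower `Bʲ(y)`,
`y ∈ Λ_j`, is a bond of `Eb j`, then `‖(−iλ_s)(x)‖ < ½α₄` on the tower and `‖R(U₀(b))(−iλ_s)(b₊) − (−iλ_s)(b₋)‖ < ½α₄·L^{−j}` on its bonds.
[cite: Balaban1985RegularSpaces, (1.102) p.93, (1.119) p.96, (1.113) p.95] -/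
theorem ball_sub_119 (hL : 1 ≤ L) (hη : 0 < η) {α₄ : ℝ} (hα₄ : 0 < α₄)
    (hEbT : ∀ j, j ≤ k → ∀ y ∈ Λs j, ∀ (x : Site d) (κ : Fin d), InBox (tlo L y j) (thi L y j) x →
      InBox (tlo L y j) (thi L y j) (x + e κ) → (x, κ) ∈ Eb j)
    (s : lamSubK η U₀ L k Eb) (hs : ‖s‖ ≤ α₄ / 4) :
    (∀ j, j ≤ k → ∀ y ∈ Λs j, ∀ x : Site d, InBox (tlo L y j) (thi L y j) x → ‖((-I) • lamOf s) x‖ < α₄ / 2) ∧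
      ∀ j, j ≤ k → ∀ y ∈ Λs j, ∀ (x : Site d) (κ : Fin d), InBox (tlo L y j) (thi L y j) x →
        InBox (tlo L y j) (thi L y j) (x + e κ) →
          ‖cj (U₀ x κ) (((-I) • lamOf s) (x + e κ)) - ((-I) • lamOf s) x‖ < α₄ / 2 * ((L : ℝ) ^ j)⁻¹ := by
  refine ⟨fun j _ y _ x _ => ?_, fun j hj y hy x κ hx hxe => ?_⟩
  · rw [Pi.smul_apply, norm_negI_smul]
    exact ((norm_lamOf_le s x).trans hs).trans_lt (by linarith)
  · have hLj : (0 : ℝ) < ((L : ℝ) ^ j)⁻¹ := by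
      have : (0 : ℝ) < L := by exact_mod_cast hL
      positivity
    rw [Pi.smul_apply, Pi.smul_apply, cj_smul_complex, ← smul_sub, norm_negI_smul]
    calc ‖cj (U₀ x κ) (lamOf s (x + e κ)) - lamOf s x‖ ≤ ‖s‖ * ((L : ℝ) ^ j)⁻¹ :=
          norm_cjDiff_lamOf_le hL hη s hj (hEbT j hj y hy x κ hx hxe)
      _ ≤ α₄ / 4 * ((L : ℝ) ^ j)⁻¹ := mul_le_mul_of_nonneg_right hs hLj.le
      _ < α₄ / 2 * ((L : ℝ) ^ j)⁻¹ := mul_lt_mul_of_pos_right (by linarith) hLj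

omit [Nontrivial 𝔸] in
/-- **The difference modulus of `λ_E,s − λ_E,t = −i(λ_s − λ_t)` on the towers is `‖s − t‖`** (sites and bonds).
[cite: Balaban1985RegularSpaces, (1.105)–(1.106) p.94, (1.125) p.97] -/
theorem ball_diff_modulus (hL : 1 ≤ L) (hη : 0 < η)
    (hEbT : ∀ j, j ≤ k → ∀ y ∈ Λs j, ∀ (x : Site d) (κ : Fin d), InBox (tlo L y j) (thi L y j) x →
      InBox (tlo L y j) (thi L y j) (x + e κ) → (x, κ) ∈ Eb j)
    (s t : lamSubK η U₀ L k Eb) :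
    (∀ j, j ≤ k → ∀ y ∈ Λs j, ∀ x : Site d, InBox (tlo L y j) (thi L y j) x → ‖((-I) • lamOf s - (-I) • lamOf t) x‖ ≤ ‖s - t‖) ∧
      ∀ j, j ≤ k → ∀ y ∈ Λs j, ∀ (x : Site d) (κ : Fin d), InBox (tlo L y j) (thi L y j) x →
        InBox (tlo L y j) (thi L y j) (x + e κ) →
          ‖cj (U₀ x κ) (((-I) • lamOf s - (-I) • lamOf t) (x + e κ)) - ((-I) • lamOf s - (-I) • lamOf t) x‖ ≤
            ‖s - t‖ * ((L : ℝ) ^ j)⁻¹ := by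
  have hfun : (-I) • lamOf s - (-I) • lamOf t = (-I) • lamOf (s - t) := by rw [lamOf_sub, smul_sub]
  rw [hfun]
  refine ⟨fun j _ y _ x _ => ?_, fun j hj y hy x κ hx hxe => ?_⟩
  · rw [Pi.smul_apply, norm_negI_smul]
    exact norm_lamOf_le (s - t) x
  · rw [Pi.smul_apply, Pi.smul_apply, cj_smul_complex, ← smul_sub, norm_negI_smul]
    exact norm_cjDiff_lamOf_le hL hη (s - t) hj (hEbT j hj y hy x κ hx hxe)

/-- **Tower bonds are bonds of `Eb j` under the admissibility record**: if each `Ω_j` is a union of `j`-blocks (`DomainSeq`), `Λ_j ⊂ Ω_j^{(j)}`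
(base corners `Lʲy ∈ Ω_j`) and `Eb j` contains both bonds at every site of `Ω_j`, then every bond of `Bʲ(y)`, `y ∈ Λ_j`, lies in `Eb j`.
[cite: Balaban1985RegularSpaces, (1.3)–(1.5) p.77, p.81] -/
theorem hEbT_of_domainSeq (hL : 1 ≤ L) {Ω : ℕ → Set (Site d)} (hΩ : B8ConstraintBonds.DomainSeq L Ω)
    (hΛ : ∀ j, j ≤ k → ∀ y ∈ Λs j, tlo L y j ∈ Ω j)
    (hEbΩ : ∀ j, j ≤ k → ∀ x ∈ Ω j, ∀ μ : Fin d, (x, μ) ∈ Eb j ∧ (x - e μ, μ) ∈ Eb j) :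
    ∀ j, j ≤ k → ∀ y ∈ Λs j, ∀ (x : Site d) (κ : Fin d), InBox (tlo L y j) (thi L y j) x →
      InBox (tlo L y j) (thi L y j) (x + e κ) → (x, κ) ∈ Eb j :=
  fun j hj y hy x κ hx _ => (hEbΩ j hj x (B8SectEKLevelDomainSeq.mem_of_inBox_tower_of_domainSeq hL hΩ (hΛ j hj y hy) hx) κ).1

end Ball

/-! ## §2 `D′` for `λ_E = −iλ_s` on the ¼α₄-ball: existence, bounds, (1.117) and (1.114) (n05-b's Sect. E BY NAME, inverse pair) -/

section SectE

variable {L k : ℕ} {η : ℝ} {Λs : ℕ → Set (Site d)} {Eb : ℕ → Set (Site d × Fin d)} {U₀ : Site d → Fin d → 𝔸ˣ}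
  {B : Site d → Fin d → 𝔸} {u₁ : Site d → 𝔸ˣ} {α₀ αP α₄ c B₀' : ℝ}

omit [Nontrivial 𝔸] in
/-- The tower form of the `H′`-modulus (n05-b's `hH1`) from its `Eb`-weighted form. [cite: Balaban1985RegularSpaces, (1.92) p.91, (1.119) p.96] -/
theorem hH1_tower (hL1 : 1 ≤ L) (hη : 0 < η) (H' : XSpace d k 𝔸 →ₗ[ℂ] (Site d → 𝔸))
    (hEbT : ∀ j, j ≤ k → ∀ y ∈ Λs j, ∀ (x : Site d) (κ : Fin d), InBox (tlo L y j) (thi L y j) x →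
      InBox (tlo L y j) (thi L y j) (x + e κ) → (x, κ) ∈ Eb j)
    (hH1 : ∀ j, j ≤ k → ∀ (X : XSpace d k 𝔸), ∀ p ∈ Eb j, wt L η j * ‖covDerivFwd η U₀ p.2 (H' X) p.1‖ ≤ B₀' * ‖X‖) :
    ∀ j, j ≤ k → ∀ y ∈ Λs j, ∀ (X : XSpace d k 𝔸) (x : Site d) (κ : Fin d), InBox (tlo L y j) (thi L y j) x →
      InBox (tlo L y j) (thi L y j) (x + e κ) → ‖cj (U₀ x κ) (H' X (x + e κ)) - H' X x‖ ≤ B₀' * ‖X‖ * ((L : ℝ) ^ j)⁻¹ :=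
  fun j hj y hy X x κ hx hxe => cjDiff_le_of_weighted hL1 hη (hH1 j hj X (x, κ) (hEbT j hj y hy x κ hx hxe))

/-- **SECT. E'S `D′(u₁⁻¹, −iλ_s)` ON THE ¼α₄-BALL OF (1.102)** — n04-b's `B8SectEKLevelInLambda.exists_Dprime_kLevel_inv_of_axial` (over n05-b's
`B8Eq1117KLevel`) BY NAME at `λ_E := −iλ_s` for the inverse pair `(·, u₁⁻¹)` of the (a″) ruling (same background `U₀`; every hypothesis AT `u₁`:
the datum's (1.34) `InAx`, (1.29) `Restr129`, (1.69), unitarity and plaquette regularity of `U₁U₀`): there is `X = D′(−iλ_s)` with `‖X‖ ≤ α₄/(2B′₀)`, `‖X‖ ≤ C2p(α₃ + α₄)α₄`, vanishing off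
`𝔅_k`, solving (1.117) `C′_j(u₁⁻¹, −iλ_s − H′X)(y) = X(j, y)` on `𝔅_k`, and (1.114) `Q′_j(u₁⁻¹, e^{−iλ_s − H′X})(y) = (Q′_j(−iλ_s))(y)` there.
Tower-local regime as in n04-b/n05-b ((1.33) on `Bʲ(y)`, (1.69) `|B_b| ≤ c L^{−j}`, `H′`'s (1.92)₁,₂ and `Q′H′ = I` on `𝔅_k`, the eight windows,
`2048·d·c ≤ 1`, print's «α₃ + α₄ ≦ 1/(4B′₀C′₂)»); tower bonds in `Eb j`.
[cite: Balaban1985RegularSpaces, (1.113)–(1.121) pp.95–97, (1.92) p.91, (1.102) p.93; Balaban1985Averaging, (213)–(214) p.50] -/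
theorem sectE_exists (hL : 2 ≤ L) (hη : 0 < η) (hU₀ : ∀ x κ, U₀ x κ ∈ unitaryUnits 𝔸) (H' : XSpace d k 𝔸 →ₗ[ℂ] (Site d → 𝔸))
    (hα : 0 < α₀) (hα3 : C0 d * α₀ ≤ 1 / 3) (hα4 : 4 * α₀ ≤ c2' d L) (hc : 0 ≤ c) (hα₄ : 0 < α₄) (hB : 0 < B₀')
    (h33 : ∀ j, j ≤ k → ∀ y ∈ Λs j, pdevOn (tlo L y j) (thi L y j) U₀ < α₀ * (((L : ℝ) ^ j)⁻¹) ^ 2)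
    (h69 : ∀ j, j ≤ k → ∀ y ∈ Λs j, ∀ (x : Site d) (κ : Fin d), InBox (tlo L y j) (thi L y j) x →
      InBox (tlo L y j) (thi L y j) (x + e κ) → ‖B x κ‖ ≤ c * ((L : ℝ) ^ j)⁻¹)
    (hd : 1 ≤ d) (hαP : 0 < αP) (hαP3 : C0 d * αP ≤ 1 / 3) (hαP2 : 2 * αP ≤ c2' d L)
    (hBu : ∀ (x : Site d) (κ : Fin d), expCfg B x κ ∈ unitaryUnits 𝔸)
    (hP : ∀ j, j ≤ k → ∀ y ∈ Λs j, pdevOn (tlo L y j) (thi L y j) (expCfg B * U₀) < αP * (((L : ℝ) ^ j)⁻¹) ^ 2)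
    (hAx : InAx L k Λs U₀ (mgauge U₀ u₁ (expCfg B) * U₀)) (h129 : Restr129 L k Λs U₀ u₁)
    (hEbT : ∀ j, j ≤ k → ∀ y ∈ Λs j, ∀ (x : Site d) (κ : Fin d), InBox (tlo L y j) (thi L y j) x →
      InBox (tlo L y j) (thi L y j) (x + e κ) → (x, κ) ∈ Eb j)
    (hH0 : ∀ (X : XSpace d k 𝔸) (x : Site d), ‖H' X x‖ ≤ B₀' * ‖X‖)
    (hH1 : ∀ j, j ≤ k → ∀ (X : XSpace d k 𝔸), ∀ p ∈ Eb j, wt L η j * ‖covDerivFwd η U₀ p.2 (H' X) p.1‖ ≤ B₀' * ‖X‖)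
    (hQH : ∀ (Y : XSpace d k 𝔸) (j : ℕ) (hj : j ≤ k) (y : Site d), y ∈ Λs j →
      QprimeIter (zdBlocking d L) (bgT L U₀) j (H' Y) y = Y (⟨j, Nat.lt_succ_of_le hj⟩, y))
    (hsmall : Real.exp (4 * (800 * ((d : ℝ) + 1) ^ 2 * ((d : ℝ) + 4)) * α₀) * (1 + 8 * (131072 * ((d : ℝ) + 1) ^ 2) * c) ≤ 2)
    (hc₃ : 2 * c ≤ c3 d L) (hsc : 2048 * (d : ℝ) * c ≤ 1) (hα₃' : 40 * d * c ≤ 1 / 200)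
    (hs₁ : 200 * C6 d * (2 * α₄) ≤ 1) (hs₂ : 12000 * ((d : ℝ) + 1) * L * (2 * α₄) ≤ 1)
    (hs₃ : C4G d L * (α₀ + 40 * d * c + 4 * (2 * α₄)) ≤ 1)
    (hs₄ : 1024 * ((d : ℝ) + 1) * ((d : ℝ) + 4) * L ^ 2 * α₀ ≤ 1) (hs₅ : 32 * ((d : ℝ) + 1) ^ 2 * C6 d * L ^ 2 * α₀ ≤ 1)
    (hs₆ : 16 * d * C5' d * C6 d * (L : ℝ) ^ 2 * α₀ ≤ 1) (hs₇ : 8 * d * C6 d * L * α₀ ≤ 1)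
    (hsm : 40 * d * c + α₄ ≤ 1 / (4 * B₀' * (2 * C2p d)))
    (s : lamSubK η U₀ L k Eb) (hs : ‖s‖ ≤ α₄ / 4) :
    ∃ X : XSpace d k 𝔸, ‖X‖ ≤ α₄ / (2 * B₀') ∧ ‖X‖ ≤ C2p d * (40 * d * c + α₄) * α₄ ∧
      (∀ (j : ℕ) (hj : j ≤ k) (y : Site d), y ∉ Λs j → X (⟨j, Nat.lt_succ_of_le hj⟩, y) = 0) ∧
      (∀ (j : ℕ) (hj : j ≤ k) (y : Site d), y ∈ Λs j →
        Cnl L U₀ u₁⁻¹ j ((-I) • lamOf s - H' X) y = X (⟨j, Nat.lt_succ_of_le hj⟩, y)) ∧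
      ∀ (j : ℕ), j ≤ k → ∀ y ∈ Λs j,
        Qnl L U₀ (fun x => expUnit (((-I) • lamOf s - H' X) x)) u₁⁻¹ j y =
          QprimeIter (zdBlocking d L) (bgT L U₀) j ((-I) • lamOf s) y := by
  have hL1 : 1 ≤ L := le_trans (by norm_num) hL
  obtain ⟨h119b, h119a⟩ := ball_sub_119 (Λs := Λs) hL1 hη hα₄ hEbT s hs
  exact exists_Dprime_kLevel_inv_of_axial (Λ := Λs) (lam := (-I) • lamOf s) hd hL hL1 hU₀ hα hα3 hα4 hc hα₄ hB hαP hαP3 hαP2 hBu h33 h69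
    hP hAx h129 h119b h119a hH0 (hH1_tower hL1 hη H' hEbT hH1) hQH hsmall hc₃ hsc hα₃' hs₁ hs₂ hs₃ hs₄ hs₅ hs₆ hs₇ hsm

/-- **`D′(u₁⁻¹, −iλ)` IS LIPSCHITZ ON THE ¼α₄-BALL WITH THE (1.102) NORM** — n04-b's `B8SectEKLevelInLambda.Dprime_lipschitz_kLevel_inv_of_axial`
(over n05-b's `B8DprimeKLevelLipschitz.Dprime_lipschitz_kLevel`) BY NAME:
any two solutions `X_s`, `X_t` of (1.117) in the ball `α₄/(2B′₀)` for `−iλ_s`, `−iλ_t` (vanishing off `𝔅_k`) satisfy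
`‖X_s − X_t‖ ≤ 4·C2p·(α₃ + 2α₄)·‖s − t‖`.  At `s = t` this is «exactly one solution» (p. 97).
[cite: Balaban1985RegularSpaces, p.97 (after (1.125)), (1.117)–(1.125) pp.96–97, (1.105)–(1.106) p.94] -/
theorem sectE_lipschitz (hL : 2 ≤ L) (hη : 0 < η) (hU₀ : ∀ x κ, U₀ x κ ∈ unitaryUnits 𝔸) (H' : XSpace d k 𝔸 →ₗ[ℂ] (Site d → 𝔸))
    (hα : 0 < α₀) (hα3 : C0 d * α₀ ≤ 1 / 3) (hα4 : 4 * α₀ ≤ c2' d L) (hc : 0 ≤ c) (hα₄ : 0 < α₄) (hB : 0 < B₀')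
    (h33 : ∀ j, j ≤ k → ∀ y ∈ Λs j, pdevOn (tlo L y j) (thi L y j) U₀ < α₀ * (((L : ℝ) ^ j)⁻¹) ^ 2)
    (h69 : ∀ j, j ≤ k → ∀ y ∈ Λs j, ∀ (x : Site d) (κ : Fin d), InBox (tlo L y j) (thi L y j) x →
      InBox (tlo L y j) (thi L y j) (x + e κ) → ‖B x κ‖ ≤ c * ((L : ℝ) ^ j)⁻¹)
    (hd : 1 ≤ d) (hαP : 0 < αP) (hαP3 : C0 d * αP ≤ 1 / 3) (hαP2 : 2 * αP ≤ c2' d L)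
    (hBu : ∀ (x : Site d) (κ : Fin d), expCfg B x κ ∈ unitaryUnits 𝔸)
    (hP : ∀ j, j ≤ k → ∀ y ∈ Λs j, pdevOn (tlo L y j) (thi L y j) (expCfg B * U₀) < αP * (((L : ℝ) ^ j)⁻¹) ^ 2)
    (hAx : InAx L k Λs U₀ (mgauge U₀ u₁ (expCfg B) * U₀)) (h129 : Restr129 L k Λs U₀ u₁)
    (hEbT : ∀ j, j ≤ k → ∀ y ∈ Λs j, ∀ (x : Site d) (κ : Fin d), InBox (tlo L y j) (thi L y j) x →
      InBox (tlo L y j) (thi L y j) (x + e κ) → (x, κ) ∈ Eb j)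
    (hH0 : ∀ (X : XSpace d k 𝔸) (x : Site d), ‖H' X x‖ ≤ B₀' * ‖X‖)
    (hH1 : ∀ j, j ≤ k → ∀ (X : XSpace d k 𝔸), ∀ p ∈ Eb j, wt L η j * ‖covDerivFwd η U₀ p.2 (H' X) p.1‖ ≤ B₀' * ‖X‖)
    (hsmall : Real.exp (4 * (800 * ((d : ℝ) + 1) ^ 2 * ((d : ℝ) + 4)) * α₀) * (1 + 8 * (131072 * ((d : ℝ) + 1) ^ 2) * c) ≤ 2)
    (hc₃ : 2 * c ≤ c3 d L) (hsc : 2048 * (d : ℝ) * c ≤ 1) (hα₃' : 40 * d * c ≤ 1 / 200)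
    (hs₁ : 200 * C6 d * (2 * α₄) ≤ 1) (hs₂ : 12000 * ((d : ℝ) + 1) * L * (2 * α₄) ≤ 1)
    (hs₃ : C4G d L * (α₀ + 40 * d * c + 4 * (2 * α₄)) ≤ 1)
    (hs₄ : 1024 * ((d : ℝ) + 1) * ((d : ℝ) + 4) * L ^ 2 * α₀ ≤ 1) (hs₅ : 32 * ((d : ℝ) + 1) ^ 2 * C6 d * L ^ 2 * α₀ ≤ 1)
    (hs₆ : 16 * d * C5' d * C6 d * (L : ℝ) ^ 2 * α₀ ≤ 1) (hs₇ : 8 * d * C6 d * L * α₀ ≤ 1)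
    (hsm : 40 * d * c + α₄ ≤ 1 / (4 * B₀' * (2 * C2p d)))
    (s t : lamSubK η U₀ L k Eb) (hs : ‖s‖ ≤ α₄ / 4) (ht : ‖t‖ ≤ α₄ / 4)
    {X Y : XSpace d k 𝔸} (hXρ : ‖X‖ ≤ α₄ / (2 * B₀')) (hYρ : ‖Y‖ ≤ α₄ / (2 * B₀'))
    (hXzero : ∀ (j : ℕ) (hj : j ≤ k) (y : Site d), y ∉ Λs j → X (⟨j, Nat.lt_succ_of_le hj⟩, y) = 0)
    (hXfix : ∀ (j : ℕ) (hj : j ≤ k) (y : Site d), y ∈ Λs j →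
      Cnl L U₀ u₁⁻¹ j ((-I) • lamOf s - H' X) y = X (⟨j, Nat.lt_succ_of_le hj⟩, y))
    (hYzero : ∀ (j : ℕ) (hj : j ≤ k) (y : Site d), y ∉ Λs j → Y (⟨j, Nat.lt_succ_of_le hj⟩, y) = 0)
    (hYfix : ∀ (j : ℕ) (hj : j ≤ k) (y : Site d), y ∈ Λs j →
      Cnl L U₀ u₁⁻¹ j ((-I) • lamOf t - H' Y) y = Y (⟨j, Nat.lt_succ_of_le hj⟩, y)) :
    ‖X - Y‖ ≤ 4 * C2p d * (40 * d * c + 2 * α₄) * ‖s - t‖ := by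
  have hL1 : 1 ≤ L := le_trans (by norm_num) hL
  obtain ⟨h₁b, h₁a⟩ := ball_sub_119 (Λs := Λs) hL1 hη hα₄ hEbT s hs
  obtain ⟨h₂b, h₂a⟩ := ball_sub_119 (Λs := Λs) hL1 hη hα₄ hEbT t ht
  obtain ⟨hmb, hma⟩ := ball_diff_modulus (Λs := Λs) hL1 hη hEbT s t
  exact Dprime_lipschitz_kLevel_inv_of_axial (Λ := Λs) (lam₁ := (-I) • lamOf s) (lam₂ := (-I) • lamOf t) hd hL hL1 hU₀ hα hα3 hα4 hc
    hα₄ hB (norm_nonneg _) hαP hαP3 hαP2 hBu h33 h69 hP hAx h129 h₁b h₁a h₂b h₂a hmb hma hH0 (hH1_tower hL1 hη H' hEbT hH1) hsmall hc₃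
    hsc hα₃' hs₁ hs₂ hs₃ hs₄ hs₅ hs₆ hs₇ hsm hXρ hYρ hXzero hXfix hYzero hYfix

/-- **`D′(u₁⁻¹, −iλ_s)` IS REAL FOR HERMITIAN `λ_s`** (tacit in print, where everything is `U(N)`-valued): if [3]'s remainder `C′_j(u₁⁻¹, ·)` is
covariant under `μ ↦ −μ*` on the (1.120)-set of the tower (`hCequiv`) and [4]'s `H′` under `X ↦ −X*` (`hHequiv`), then for Hermitian `λ_s` the reflected
family `−X*` solves (1.117) for the same `−iλ_s` in the same ball, so by «exactly one solution» (`sectE_lipschitz` at `s = t`) `X(j, y)* = −X(j, y)`.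
[cite: Balaban1985RegularSpaces, p.97 (exactly one solution), p.93 (real configurations); Balaban1985Averaging, (22)–(23) p.21, (208) p.50] -/
theorem sectE_real (hL : 2 ≤ L) (hη : 0 < η) (hU₀ : ∀ x κ, U₀ x κ ∈ unitaryUnits 𝔸) (H' : XSpace d k 𝔸 →ₗ[ℂ] (Site d → 𝔸))
    (hα : 0 < α₀) (hα3 : C0 d * α₀ ≤ 1 / 3) (hα4 : 4 * α₀ ≤ c2' d L) (hc : 0 ≤ c) (hα₄ : 0 < α₄) (hB : 0 < B₀')
    (h33 : ∀ j, j ≤ k → ∀ y ∈ Λs j, pdevOn (tlo L y j) (thi L y j) U₀ < α₀ * (((L : ℝ) ^ j)⁻¹) ^ 2)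
    (h69 : ∀ j, j ≤ k → ∀ y ∈ Λs j, ∀ (x : Site d) (κ : Fin d), InBox (tlo L y j) (thi L y j) x →
      InBox (tlo L y j) (thi L y j) (x + e κ) → ‖B x κ‖ ≤ c * ((L : ℝ) ^ j)⁻¹)
    (hd : 1 ≤ d) (hαP : 0 < αP) (hαP3 : C0 d * αP ≤ 1 / 3) (hαP2 : 2 * αP ≤ c2' d L)
    (hBu : ∀ (x : Site d) (κ : Fin d), expCfg B x κ ∈ unitaryUnits 𝔸)
    (hP : ∀ j, j ≤ k → ∀ y ∈ Λs j, pdevOn (tlo L y j) (thi L y j) (expCfg B * U₀) < αP * (((L : ℝ) ^ j)⁻¹) ^ 2)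
    (hAx : InAx L k Λs U₀ (mgauge U₀ u₁ (expCfg B) * U₀)) (h129 : Restr129 L k Λs U₀ u₁)
    (hEbT : ∀ j, j ≤ k → ∀ y ∈ Λs j, ∀ (x : Site d) (κ : Fin d), InBox (tlo L y j) (thi L y j) x →
      InBox (tlo L y j) (thi L y j) (x + e κ) → (x, κ) ∈ Eb j)
    (hH0 : ∀ (X : XSpace d k 𝔸) (x : Site d), ‖H' X x‖ ≤ B₀' * ‖X‖)
    (hH1 : ∀ j, j ≤ k → ∀ (X : XSpace d k 𝔸), ∀ p ∈ Eb j, wt L η j * ‖covDerivFwd η U₀ p.2 (H' X) p.1‖ ≤ B₀' * ‖X‖)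
    (hHequiv : ∀ X Y : XSpace d k 𝔸, (∀ p, Y p = -star (X p)) → ∀ x, H' Y x = -star (H' X x))
    (hCequiv : ∀ j, j ≤ k → ∀ y ∈ Λs j, ∀ μ : Site d → 𝔸,
      (∀ x : Site d, InBox (tlo L y j) (thi L y j) x → ‖μ x‖ < α₄) →
      (∀ (x : Site d) (κ : Fin d), InBox (tlo L y j) (thi L y j) x → InBox (tlo L y j) (thi L y j) (x + e κ) →
        ‖cj (U₀ x κ) (μ (x + e κ)) - μ x‖ < α₄ * ((L : ℝ) ^ j)⁻¹) →
      Cnl L U₀ u₁⁻¹ j (fun x => -star (μ x)) y = -star (Cnl L U₀ u₁⁻¹ j μ y))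
    (hsmall : Real.exp (4 * (800 * ((d : ℝ) + 1) ^ 2 * ((d : ℝ) + 4)) * α₀) * (1 + 8 * (131072 * ((d : ℝ) + 1) ^ 2) * c) ≤ 2)
    (hc₃ : 2 * c ≤ c3 d L) (hsc : 2048 * (d : ℝ) * c ≤ 1) (hα₃' : 40 * d * c ≤ 1 / 200)
    (hs₁ : 200 * C6 d * (2 * α₄) ≤ 1) (hs₂ : 12000 * ((d : ℝ) + 1) * L * (2 * α₄) ≤ 1)
    (hs₃ : C4G d L * (α₀ + 40 * d * c + 4 * (2 * α₄)) ≤ 1)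
    (hs₄ : 1024 * ((d : ℝ) + 1) * ((d : ℝ) + 4) * L ^ 2 * α₀ ≤ 1) (hs₅ : 32 * ((d : ℝ) + 1) ^ 2 * C6 d * L ^ 2 * α₀ ≤ 1)
    (hs₆ : 16 * d * C5' d * C6 d * (L : ℝ) ^ 2 * α₀ ≤ 1) (hs₇ : 8 * d * C6 d * L * α₀ ≤ 1)
    (hsm : 40 * d * c + α₄ ≤ 1 / (4 * B₀' * (2 * C2p d)))
    (s : lamSubK η U₀ L k Eb) (hs : ‖s‖ ≤ α₄ / 4) (hsa : ∀ x, IsSelfAdjoint (lamOf s x))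
    {X : XSpace d k 𝔸} (hXρ : ‖X‖ ≤ α₄ / (2 * B₀'))
    (hXzero : ∀ (j : ℕ) (hj : j ≤ k) (y : Site d), y ∉ Λs j → X (⟨j, Nat.lt_succ_of_le hj⟩, y) = 0)
    (hXfix : ∀ (j : ℕ) (hj : j ≤ k) (y : Site d), y ∈ Λs j →
      Cnl L U₀ u₁⁻¹ j ((-I) • lamOf s - H' X) y = X (⟨j, Nat.lt_succ_of_le hj⟩, y)) :
    ∀ p, star (X p) = -X p := by
  have hL1 : 1 ≤ L := le_trans (by norm_num) hL
  -- the reflected family `−X*`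
  have hbd : ∀ p, ‖-star (X p)‖ ≤ ‖X‖ := fun p => by
    rw [norm_neg, norm_star]; exact X.norm_coe_le_norm p
  set Y : XSpace d k 𝔸 := BoundedContinuousFunction.ofNormedAddCommGroupDiscrete (fun p => -star (X p)) ‖X‖ hbd with hYdef
  have hYp : ∀ p, Y p = -star (X p) := fun p => rfl
  have hYρ : ‖Y‖ ≤ α₄ / (2 * B₀') :=
    ((BoundedContinuousFunction.norm_le (norm_nonneg X)).2 fun p => by rw [hYp]; exact hbd p).trans hXρ
  have hYzero : ∀ (j : ℕ) (hj : j ≤ k) (y : Site d), y ∉ Λs j → Y (⟨j, Nat.lt_succ_of_le hj⟩, y) = 0 := fun j hj y hy => by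
    rw [hYp, hXzero j hj y hy, star_zero, neg_zero]
  have hHY : H' Y = fun x => -star (H' X x) := funext (hHequiv X Y hYp)
  have hμ : (-I) • lamOf s - H' Y = fun x => -star (((-I) • lamOf s - H' X) x) := by
    funext x
    rw [hHY, Pi.sub_apply, Pi.smul_apply, Pi.sub_apply, Pi.smul_apply, star_sub, star_negI_smul_of_sa (hsa x)]
    abel
  have hYfix : ∀ (j : ℕ) (hj : j ≤ k) (y : Site d), y ∈ Λs j →
      Cnl L U₀ u₁⁻¹ j ((-I) • lamOf s - H' Y) y = Y (⟨j, Nat.lt_succ_of_le hj⟩, y) := by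
    intro j hj y hy
    obtain ⟨h119b, h119a⟩ := ball_sub_119 (Λs := Λs) hL1 hη hα₄ hEbT s hs
    obtain ⟨ha, hb⟩ := dom120_of_119_tower H' hB (by positivity) hH0 ((hH1_tower hL1 hη H' hEbT hH1) j hj y hy) (h119a j hj y hy)
      (h119b j hj y hy) hXρ
    rw [hμ, hCequiv j hj y hy _ hb ha, hXfix j hj y hy, hYp]
  have hXY := sectE_lipschitz hL hη hU₀ H' hα hα3 hα4 hc hα₄ hB h33 h69 hd hαP hαP3 hαP2 hBu hP hAx h129 hEbT hH0 hH1 hsmall hc₃ hsc hα₃' hs₁ hs₂ hs₃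
    hs₄ hs₅ hs₆ hs₇ hsm s s hs hs hXρ hYρ hXzero hXfix hYzero hYfix
  rw [sub_self, norm_zero, mul_zero] at hXY
  have hXYeq : X = Y := sub_eq_zero.1 (norm_le_zero_iff.1 hXY)
  intro p
  have h1 : X p = -star (X p) := by rw [← hYp p, ← hXYeq]
  have h2 := congrArg star h1
  rw [star_neg, star_star] at h2
  exact h2

end SectE

/-! ## §3 (1.114) for the inverse pair ⇒ (1.79): `Q′λ = 0 ⇒ Q′(u₁⁻¹, e^{−iλ′}) = 0` on `𝔅_k` -/

section Cond179

variable {L k : ℕ} {η : ℝ} {Λs : ℕ → Set (Site d)} {Eb : ℕ → Set (Site d × Fin d)} {U₀ : Site d → Fin d → 𝔸ˣ} {u₁ : Site d → 𝔸ˣ}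

omit [Nontrivial 𝔸] in
/-- **SECT. E'S (1.114) IN ITS PRINTED USE** («thus `Q′(u₁, λ′) = 0`», p. 95) for the inverse pair of the (a″) ruling: with `λ′ = λ_s − iH′X` (so that
`(e^{iλ′})⁻¹ = e^{−iλ_s − H′X}` pointwise) and (1.114) `Q′_j(u₁⁻¹, e^{−iλ_s − H′X}) = Q′_j(−iλ_s)` on `𝔅_k`, the LINEAR constraint `Q′λ_s = 0` (the letter
`q` of [4] read as `Q′_j(U₀)` on `Λ_j`) gives (1.79) `Q′(u₁⁻¹, (e^{iλ′})⁻¹) = 0` on `𝔅_k` — `Q′_j` is `ℂ`-linear, so `Q′_j(−iλ_s) = −iQ′_jλ_s = 0`.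
[cite: Balaban1985RegularSpaces, (1.113)–(1.114) p.95, (1.79) p.90, (1.95) p.92] -/
theorem cond179_of_eq114 (H' : XSpace d k 𝔸 →ₗ[ℂ] (Site d → 𝔸)) (q : (Site d → 𝔸) →ₗ[ℂ] (ℕ → Site d → 𝔸))
    (hq : ∀ (f : Site d → 𝔸) (j : ℕ), j ≤ k → ∀ y ∈ Λs j, q f j y = QprimeIter (zdBlocking d L) (bgT L U₀) j f y)
    (s : lamSubK η U₀ L k Eb) {X : XSpace d k 𝔸}
    (he114 : ∀ (j : ℕ), j ≤ k → ∀ y ∈ Λs j,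
      Qnl L U₀ (fun x => expUnit (((-I) • lamOf s - H' X) x)) u₁⁻¹ j y = QprimeIter (zdBlocking d L) (bgT L U₀) j ((-I) • lamOf s) y)
    (hq0 : q (lamOf s) = 0) :
    Cond179 L k Λs U₀ (gaugeExp (lamOf s + (-I) • H' X))⁻¹ u₁⁻¹ := by
  have hfun : (gaugeExp (lamOf s + (-I) • H' X))⁻¹ = fun x => expUnit (((-I) • lamOf s - H' X) x) := by
    funext x
    rw [Pi.inv_apply, gaugeExp, val_inv_expUnit]
    congr 1
    rw [Pi.add_apply, Pi.smul_apply, smul_add, (I_smul_negI_smul _).1, neg_add, ← neg_smul, Pi.sub_apply, Pi.smul_apply,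
      sub_eq_add_neg]
  intro j hj y hy
  rw [hfun, he114 j hj y hy]
  have h := congrFun (QprimeIter_smul (zdBlocking d L) (bgT L U₀) (-I) (lamOf s) j) y
  rw [show ((-I) • lamOf s : Site d → 𝔸) = fun x => (-I) • lamOf s x from rfl, h, ← hq _ j hj y hy, hq0, Pi.zero_apply,
    Pi.zero_apply, smul_zero]

end Cond179

/-! ## §4 JOIN-C: Proposition 5's fixed point in the knit's currency with `H_c := −iH′D′(u₁⁻¹, −i·)` from Sect. E -/

section Join

variable {L k : ℕ} {η β : ℝ} {Ω Λs : ℕ → Set (Site d)} {Eb : ℕ → Set (Site d × Fin d)} {U₀ : Site d → Fin d → 𝔸ˣ}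
  {A : Site d → Fin d → 𝔸} {u₁ : Site d → 𝔸ˣ}

/-- **THE MAP `λ ↦ D′(u₁⁻¹, −iλ)` ON THE ¼α₄-BALL, CHOSEN ONCE** (p. 97 «We take D′(λ) equal to this solution»): a function `Dp` on site
functions with, for every `s` in the ¼α₄-ball of (1.102): `Dp λ_s` in the ball `α₄/(2B′₀)`, vanishing off `𝔅_k`, solving (1.117) for `−iλ_s`, of size
`≤ C2p(α₃ + α₄)α₄`, with (1.114) for the inverse pair; Lipschitz `‖Dp λ_s − Dp λ_t‖ ≤ 4C2p(α₃ + 2α₄)‖s − t‖`; and `(Dp λ_s)* = −Dp λ_s` for Hermitian `λ_s`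
(`sectE_exists` / `sectE_lipschitz` / `sectE_real`; the choice is by `Classical.choice`, unique by «exactly one solution»).
[cite: Balaban1985RegularSpaces, (1.113)–(1.121) pp.95–97, p.97 (exactly one solution; analytic function of λ)] -/
theorem exists_Dprime_map (hL : 2 ≤ L) (hη : 0 < η) (hU₀ : ∀ x κ, U₀ x κ ∈ unitaryUnits 𝔸) (H' : XSpace d k 𝔸 →ₗ[ℂ] (Site d → 𝔸))
    {B : Site d → Fin d → 𝔸} {α₀ αP α₄ cB B₀' : ℝ}
    (hα : 0 < α₀) (hα3 : C0 d * α₀ ≤ 1 / 3) (hα4 : 4 * α₀ ≤ c2' d L) (hcB : 0 ≤ cB) (hα₄ : 0 < α₄) (hB : 0 < B₀')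
    (h33 : ∀ j, j ≤ k → ∀ y ∈ Λs j, pdevOn (tlo L y j) (thi L y j) U₀ < α₀ * (((L : ℝ) ^ j)⁻¹) ^ 2)
    (h69 : ∀ j, j ≤ k → ∀ y ∈ Λs j, ∀ (x : Site d) (κ : Fin d), InBox (tlo L y j) (thi L y j) x →
      InBox (tlo L y j) (thi L y j) (x + e κ) → ‖B x κ‖ ≤ cB * ((L : ℝ) ^ j)⁻¹)
    (hd : 1 ≤ d) (hαP : 0 < αP) (hαP3 : C0 d * αP ≤ 1 / 3) (hαP2 : 2 * αP ≤ c2' d L)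
    (hBu : ∀ (x : Site d) (κ : Fin d), expCfg B x κ ∈ unitaryUnits 𝔸)
    (hP : ∀ j, j ≤ k → ∀ y ∈ Λs j, pdevOn (tlo L y j) (thi L y j) (expCfg B * U₀) < αP * (((L : ℝ) ^ j)⁻¹) ^ 2)
    (hAx : InAx L k Λs U₀ (mgauge U₀ u₁ (expCfg B) * U₀)) (h129 : Restr129 L k Λs U₀ u₁)
    (hEbT : ∀ j, j ≤ k → ∀ y ∈ Λs j, ∀ (x : Site d) (κ : Fin d), InBox (tlo L y j) (thi L y j) x →
      InBox (tlo L y j) (thi L y j) (x + e κ) → (x, κ) ∈ Eb j)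
    (hH0 : ∀ (X : XSpace d k 𝔸) (x : Site d), ‖H' X x‖ ≤ B₀' * ‖X‖)
    (hH1 : ∀ j, j ≤ k → ∀ (X : XSpace d k 𝔸), ∀ p ∈ Eb j, wt L η j * ‖covDerivFwd η U₀ p.2 (H' X) p.1‖ ≤ B₀' * ‖X‖)
    (hHequiv : ∀ X Y : XSpace d k 𝔸, (∀ p, Y p = -star (X p)) → ∀ x, H' Y x = -star (H' X x))
    (hQH : ∀ (Y : XSpace d k 𝔸) (j : ℕ) (hj : j ≤ k) (y : Site d), y ∈ Λs j →
      QprimeIter (zdBlocking d L) (bgT L U₀) j (H' Y) y = Y (⟨j, Nat.lt_succ_of_le hj⟩, y))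
    (hCequiv : ∀ j, j ≤ k → ∀ y ∈ Λs j, ∀ μ : Site d → 𝔸,
      (∀ x : Site d, InBox (tlo L y j) (thi L y j) x → ‖μ x‖ < α₄) →
      (∀ (x : Site d) (κ : Fin d), InBox (tlo L y j) (thi L y j) x → InBox (tlo L y j) (thi L y j) (x + e κ) →
        ‖cj (U₀ x κ) (μ (x + e κ)) - μ x‖ < α₄ * ((L : ℝ) ^ j)⁻¹) →
      Cnl L U₀ u₁⁻¹ j (fun x => -star (μ x)) y = -star (Cnl L U₀ u₁⁻¹ j μ y))
    (hsmall : Real.exp (4 * (800 * ((d : ℝ) + 1) ^ 2 * ((d : ℝ) + 4)) * α₀) * (1 + 8 * (131072 * ((d : ℝ) + 1) ^ 2) * cB) ≤ 2)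
    (hc₃ : 2 * cB ≤ c3 d L) (hsc : 2048 * (d : ℝ) * cB ≤ 1) (hα₃' : 40 * d * cB ≤ 1 / 200)
    (hs₁ : 200 * C6 d * (2 * α₄) ≤ 1) (hs₂ : 12000 * ((d : ℝ) + 1) * L * (2 * α₄) ≤ 1)
    (hs₃ : C4G d L * (α₀ + 40 * d * cB + 4 * (2 * α₄)) ≤ 1)
    (hs₄ : 1024 * ((d : ℝ) + 1) * ((d : ℝ) + 4) * L ^ 2 * α₀ ≤ 1) (hs₅ : 32 * ((d : ℝ) + 1) ^ 2 * C6 d * L ^ 2 * α₀ ≤ 1)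
    (hs₆ : 16 * d * C5' d * C6 d * (L : ℝ) ^ 2 * α₀ ≤ 1) (hs₇ : 8 * d * C6 d * L * α₀ ≤ 1)
    (hsm : 40 * d * cB + α₄ ≤ 1 / (4 * B₀' * (2 * C2p d))) :
    ∃ Dp : (Site d → 𝔸) → XSpace d k 𝔸,
      (∀ s : lamSubK η U₀ L k Eb, ‖s‖ ≤ α₄ / 4 →
        ‖Dp (lamOf s)‖ ≤ α₄ / (2 * B₀') ∧ ‖Dp (lamOf s)‖ ≤ C2p d * (40 * d * cB + α₄) * α₄ ∧
        (∀ (j : ℕ) (hj : j ≤ k) (y : Site d), y ∉ Λs j → Dp (lamOf s) (⟨j, Nat.lt_succ_of_le hj⟩, y) = 0) ∧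
        (∀ (j : ℕ) (hj : j ≤ k) (y : Site d), y ∈ Λs j →
          Cnl L U₀ u₁⁻¹ j ((-I) • lamOf s - H' (Dp (lamOf s))) y = Dp (lamOf s) (⟨j, Nat.lt_succ_of_le hj⟩, y)) ∧
        ∀ (j : ℕ), j ≤ k → ∀ y ∈ Λs j,
          Qnl L U₀ (fun x => expUnit (((-I) • lamOf s - H' (Dp (lamOf s))) x)) u₁⁻¹ j y =
            QprimeIter (zdBlocking d L) (bgT L U₀) j ((-I) • lamOf s) y) ∧
      (∀ s t : lamSubK η U₀ L k Eb, ‖s‖ ≤ α₄ / 4 → ‖t‖ ≤ α₄ / 4 →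
        ‖Dp (lamOf s) - Dp (lamOf t)‖ ≤ 4 * C2p d * (40 * d * cB + 2 * α₄) * ‖s - t‖) ∧
      ∀ s : lamSubK η U₀ L k Eb, ‖s‖ ≤ α₄ / 4 → (∀ x, IsSelfAdjoint (lamOf s x)) → ∀ p, star (Dp (lamOf s) p) = -Dp (lamOf s) p := by
  -- a solution with all the listed properties at each λ_s of the ball, chosen once
  have key : ∀ lam : Site d → 𝔸, ∃ X : XSpace d k 𝔸, ∀ s : lamSubK η U₀ L k Eb, lamOf s = lam → ‖s‖ ≤ α₄ / 4 →
      ‖X‖ ≤ α₄ / (2 * B₀') ∧ ‖X‖ ≤ C2p d * (40 * d * cB + α₄) * α₄ ∧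
      (∀ (j : ℕ) (hj : j ≤ k) (y : Site d), y ∉ Λs j → X (⟨j, Nat.lt_succ_of_le hj⟩, y) = 0) ∧
      (∀ (j : ℕ) (hj : j ≤ k) (y : Site d), y ∈ Λs j →
        Cnl L U₀ u₁⁻¹ j ((-I) • lamOf s - H' X) y = X (⟨j, Nat.lt_succ_of_le hj⟩, y)) ∧
      ∀ (j : ℕ), j ≤ k → ∀ y ∈ Λs j,
        Qnl L U₀ (fun x => expUnit (((-I) • lamOf s - H' X) x)) u₁⁻¹ j y = QprimeIter (zdBlocking d L) (bgT L U₀) j ((-I) • lamOf s) y := by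
    intro lam
    by_cases h : ∃ s : lamSubK η U₀ L k Eb, lamOf s = lam ∧ ‖s‖ ≤ α₄ / 4
    · obtain ⟨s, rfl, hs⟩ := h
      obtain ⟨X, hX⟩ := sectE_exists hL hη hU₀ H' hα hα3 hα4 hcB hα₄ hB h33 h69 hd hαP hαP3 hαP2 hBu hP hAx h129 hEbT hH0 hH1 hQH hsmall hc₃ hsc hα₃' hs₁ hs₂
        hs₃ hs₄ hs₅ hs₆ hs₇ hsm s hs
      refine ⟨X, fun t ht _ => ?_⟩
      rw [B8LambdaSpaceKLevel.ext_of_lamOf ht]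
      exact hX
    · exact ⟨0, fun s h1 h2 => absurd ⟨s, h1, h2⟩ h⟩
  choose Dp hDp' using key
  have hDp := fun (s : lamSubK η U₀ L k Eb) (hs : ‖s‖ ≤ α₄ / 4) => hDp' (lamOf s) s rfl hs
  refine ⟨Dp, hDp, fun s t hs ht => ?_, fun s hs hsa => ?_⟩
  · exact sectE_lipschitz hL hη hU₀ H' hα hα3 hα4 hcB hα₄ hB h33 h69 hd hαP hαP3 hαP2 hBu hP hAx h129 hEbT hH0 hH1 hsmall hc₃ hsc hα₃' hs₁ hs₂ hs₃ hs₄ hs₅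
      hs₆ hs₇ hsm s t hs ht (hDp s hs).1 (hDp t ht).1 (hDp s hs).2.2.1 (hDp s hs).2.2.2.1 (hDp t ht).2.2.1 (hDp t ht).2.2.2.1
  · exact sectE_real hL hη hU₀ H' hα hα3 hα4 hcB hα₄ hB h33 h69 hd hαP hαP3 hαP2 hBu hP hAx h129 hEbT hH0 hH1 hHequiv hCequiv hsmall hc₃ hsc hα₃' hs₁ hs₂ hs₃
      hs₄ hs₅ hs₆ hs₇ hsm s hs hsa (hDp s hs).1 (hDp s hs).2.2.1 (hDp s hs).2.2.2.1

/-- **JOIN-C — PROPOSITION 5'S FIXED POINT IN THE KNIT'S CURRENCY WITH THE SECT. E CORRECTION INSTANTIATED** (the `hFP` binder of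
`B8Prop5KLevelLetters.hP5_step_of_HFP` / `B8LeafModelZdOfHFP.SockHFP`, modulo [4] letters + [3] Prop. 10 + the Sect. E regime; no free `H_c`).
`B8Prop5JoinHFP.hFP_kLevel_of179` (JOIN-B) with its eight `H_c` binders and `h179` DISCHARGED: `H_c λ := −i·H′D′(u₁⁻¹, −iλ)` where `D′` is THE solution
of (1.117) on the ¼α₄-ball (n05-b's `B8Eq1117KLevel` / `B8DprimeKLevelLipschitz` by name on the inverse pair `(e^{−iλ}, u₁⁻¹)` of the (a″) ruling,
`pub-ymgap-dag-n05-a` INBOX l.11309, same background `U₀`): sizes `h₀ = h₁ = B′₀·C2p(α₃ + α₄)α₄`, `h₂ = B′₂·C2p(α₃ + α₄)α₄`, moduli `l₀ = l₁ =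
4B′₀C2p(α₃ + 2α₄)`, `l₂ = 4B′₂C2p(α₃ + 2α₄)` (`α₃ = 40d·c_B`), reality by `sectE_real`, support by `H′`'s Dirichlet range, (1.79) by (1.114) + `Q′λ = 0`.
DISPLAYED (each named for its source): the letters `g Δ q qs Aw c` of [4] with `g_left`/`g_right`/`c_right` and readings `hΔ`/`hqs`/`hq` (`q` = `Q′_j(U₀)` on
`Λ_j`); `H′` of [4] (1.92) as a `ℂ`-linear letter with `hH0`/`hH1` (sup and `Eb`-weighted gradient, `B′₀`), `hH2` (weighted Laplacian, `B′₂`), Dirichlet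
range `hHsupp`, `Q′H′ = I` on `𝔅_k` (`hQH`, (1.91)) and the covariance `hHequiv`; [3]'s remainder covariance `hCequiv`; n05-b's tower-local Sect. E regime
in the AT-`u₁` form ((1.33) `h33`, (1.69) `h69`, `hBu`, `hP`, (1.34) `InAx` + (1.29) `Restr129` for `u₁`, the eight windows, `2048·d·c_B ≤ 1`,
«α₃ + α₄ ≦ 1/(4B′₀C′₂)»); tower bonds in `Eb j` (`hEbT`, cf.
`hEbT_of_domainSeq`); (1.101)/(1.98)R and reality/range of `G′`, `R`; the datum; JOIN-B's windows at the Sect. E sizes (`ha₁'`, `hb₁'`, `hθ`, (1.103)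
`h103`, (1.106) `h106`); [3] Prop. 10's domain/(167) inputs for the inverse pair `((e^{iλ′})⁻¹, u₁⁻¹)` for EVERY `λ′` of sup `≤ ¼α₄ + h₀` and
`Eb`-weighted gradient `≤ ¼α₄ + h₁` (`hdom`, `h167`); (1.29) for `u₁⁻¹` (`h129inv`, JOIN-B's inversion input — kept next to Sect. E's `h129`
for `u₁` until n04-b's announced `restr129_inv_of_witness` derives it).  CONCLUSION: verbatim JOIN-B's.
[cite: Balaban1985RegularSpaces, Prop. 5 (1.107)–(1.109) p.94, (1.92) p.91, (1.95)–(1.106) pp.92–94, (1.113)–(1.121) pp.95–97, (1.78)–(1.79) p.90;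
Balaban1985Averaging, Prop. 10 (166)–(167) p.44, (208), (213)–(214) p.50] -/
theorem hFP_kLevel_of_sectE (hL : 2 ≤ L) (hη : 0 < η) (hU₀ : ∀ x κ, U₀ x κ ∈ unitaryUnits 𝔸)
    (hEbΩ : ∀ j, j ≤ k → ∀ x ∈ Ω j, ∀ μ : Fin d, (x, μ) ∈ Eb j ∧ (x - e μ, μ) ∈ Eb j)
    (hEbT : ∀ j, j ≤ k → ∀ y ∈ Λs j, ∀ (x : Site d) (κ : Fin d), InBox (tlo L y j) (thi L y j) x →
      InBox (tlo L y j) (thi L y j) (x + e κ) → (x, κ) ∈ Eb j)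
    -- letters of [4]
    (g Δ : (Site d → 𝔸) →ₗ[ℂ] (Site d → 𝔸)) (q : (Site d → 𝔸) →ₗ[ℂ] (ℕ → Site d → 𝔸)) (qs : (ℕ → Site d → 𝔸) →ₗ[ℂ] (Site d → 𝔸))
    (Aw c : (ℕ → Site d → 𝔸) →ₗ[ℂ] (ℕ → Site d → 𝔸))
    (g_left : ∀ x, g (Δ x + qs (Aw (q x))) = x) (g_right : ∀ x, Δ (g x) + qs (Aw (q (g x))) = x)
    (c_right : ∀ φ, q (g (g (qs (c φ)))) = φ)
    (hΔ : ∀ (f : Site d → 𝔸), ∀ x ∈ Ω 0, Δ f x = covLap η U₀ ((Ω 0).indicator f) x)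
    (hqs : ∀ (μ : ℕ → Site d → 𝔸), ∀ x ∈ Ω 0, qs μ x = QT L k Λs U₀ μ x)
    (hq : ∀ (f : Site d → 𝔸) (j : ℕ), j ≤ k → ∀ y ∈ Λs j, q f j y = QprimeIter (zdBlocking d L) (bgT L U₀) j f y)
    -- the letter H′ of [4] ((1.92)) and the Sect. E regime (n05-b tower-local, n04-b's AT-u₁ form for the inverse pair)
    (H' : XSpace d k 𝔸 →ₗ[ℂ] (Site d → 𝔸)) {B : Site d → Fin d → 𝔸} {α₀ αP α₄ cB B₀' B₂' : ℝ}
    (hα : 0 < α₀) (hα3 : C0 d * α₀ ≤ 1 / 3) (hα4 : 4 * α₀ ≤ c2' d L) (hcB : 0 ≤ cB) (hα₄ : 0 < α₄) (hB : 0 < B₀') (hB₂ : 0 ≤ B₂')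
    (h33 : ∀ j, j ≤ k → ∀ y ∈ Λs j, pdevOn (tlo L y j) (thi L y j) U₀ < α₀ * (((L : ℝ) ^ j)⁻¹) ^ 2)
    (h69 : ∀ j, j ≤ k → ∀ y ∈ Λs j, ∀ (x : Site d) (κ : Fin d), InBox (tlo L y j) (thi L y j) x →
      InBox (tlo L y j) (thi L y j) (x + e κ) → ‖B x κ‖ ≤ cB * ((L : ℝ) ^ j)⁻¹)
    (hd : 1 ≤ d) (hαP : 0 < αP) (hαP3 : C0 d * αP ≤ 1 / 3) (hαP2 : 2 * αP ≤ c2' d L)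
    (hBu : ∀ (x : Site d) (κ : Fin d), expCfg B x κ ∈ unitaryUnits 𝔸)
    (hP : ∀ j, j ≤ k → ∀ y ∈ Λs j, pdevOn (tlo L y j) (thi L y j) (expCfg B * U₀) < αP * (((L : ℝ) ^ j)⁻¹) ^ 2)
    (hAx : InAx L k Λs U₀ (mgauge U₀ u₁ (expCfg B) * U₀)) (h129 : Restr129 L k Λs U₀ u₁)
    (hH0 : ∀ (X : XSpace d k 𝔸) (x : Site d), ‖H' X x‖ ≤ B₀' * ‖X‖)
    (hH1 : ∀ j, j ≤ k → ∀ (X : XSpace d k 𝔸), ∀ p ∈ Eb j, wt L η j * ‖covDerivFwd η U₀ p.2 (H' X) p.1‖ ≤ B₀' * ‖X‖)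
    (hH2 : ∀ X : XSpace d k 𝔸, Bd2 L η k Ω (covLap η U₀ (H' X)) (B₂' * ‖X‖))
    (hHsupp : ∀ (X : XSpace d k 𝔸) (x : Site d), x ∉ Ω 0 → H' X x = 0)
    (hHequiv : ∀ X Y : XSpace d k 𝔸, (∀ p, Y p = -star (X p)) → ∀ x, H' Y x = -star (H' X x))
    (hQH : ∀ (Y : XSpace d k 𝔸) (j : ℕ) (hj : j ≤ k) (y : Site d), y ∈ Λs j →
      QprimeIter (zdBlocking d L) (bgT L U₀) j (H' Y) y = Y (⟨j, Nat.lt_succ_of_le hj⟩, y))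
    (hCequiv : ∀ j, j ≤ k → ∀ y ∈ Λs j, ∀ μ : Site d → 𝔸,
      (∀ x : Site d, InBox (tlo L y j) (thi L y j) x → ‖μ x‖ < α₄) →
      (∀ (x : Site d) (κ : Fin d), InBox (tlo L y j) (thi L y j) x → InBox (tlo L y j) (thi L y j) (x + e κ) →
        ‖cj (U₀ x κ) (μ (x + e κ)) - μ x‖ < α₄ * ((L : ℝ) ^ j)⁻¹) →
      Cnl L U₀ u₁⁻¹ j (fun x => -star (μ x)) y = -star (Cnl L U₀ u₁⁻¹ j μ y))
    (hsmall : Real.exp (4 * (800 * ((d : ℝ) + 1) ^ 2 * ((d : ℝ) + 4)) * α₀) * (1 + 8 * (131072 * ((d : ℝ) + 1) ^ 2) * cB) ≤ 2)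
    (hc₃ : 2 * cB ≤ c3 d L) (hsc : 2048 * (d : ℝ) * cB ≤ 1) (hα₃' : 40 * d * cB ≤ 1 / 200)
    (hs₁ : 200 * C6 d * (2 * α₄) ≤ 1) (hs₂ : 12000 * ((d : ℝ) + 1) * L * (2 * α₄) ≤ 1)
    (hs₃ : C4G d L * (α₀ + 40 * d * cB + 4 * (2 * α₄)) ≤ 1)
    (hs₄ : 1024 * ((d : ℝ) + 1) * ((d : ℝ) + 4) * L ^ 2 * α₀ ≤ 1) (hs₅ : 32 * ((d : ℝ) + 1) ^ 2 * C6 d * L ^ 2 * α₀ ≤ 1)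
    (hs₆ : 16 * d * C5' d * C6 d * (L : ℝ) ^ 2 * α₀ ≤ 1) (hs₇ : 8 * d * C6 d * L * α₀ ≤ 1)
    (hsm : 40 * d * cB + α₄ ≤ 1 / (4 * B₀' * (2 * C2p d)))
    -- the Sect. E sizes of H_c (named, so that the windows below read)
    {hE hE₂ lE lE₂ : ℝ} (hE_def : hE = B₀' * (C2p d * (40 * d * cB + α₄) * α₄)) (hE₂_def : hE₂ = B₂' * (C2p d * (40 * d * cB + α₄) * α₄))
    (lE_def : lE = B₀' * (4 * C2p d * (40 * d * cB + 2 * α₄))) (lE₂_def : lE₂ = B₂' * (4 * C2p d * (40 * d * cB + 2 * α₄)))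
    -- JOIN-B's letters G′, R, the datum, and its windows at these sizes
    {BG BR cA cDA : ℝ} (hBG : 0 ≤ BG) (hBR : 0 ≤ BR) (hcA : 0 ≤ cA) (hcA' : cA ≤ 1 / 13) (hcDA : 0 ≤ cDA)
    (ha₁' : α₄ / 4 + hE ≤ 1 / 24) (hb₁' : α₄ / 4 + hE ≤ 1 / 140) (hθ : 10 * (α₄ / 4 + hE) * BR ≤ 1 / 2)
    (hG : ∀ (f : Site d → 𝔸) (m : ℝ), 0 ≤ m → Bd2 L η k Ω f m →
      (∀ x, ‖g f x‖ ≤ BG * m) ∧ ∀ j, j ≤ k → ∀ p ∈ Eb j, wt L η j * ‖covDerivFwd η U₀ p.2 (g f) p.1‖ ≤ BG * m)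
    (hGsupp : ∀ (f : Site d → 𝔸) (x : Site d), x ∉ Ω 0 → g f x = 0)
    (hGreal : ∀ f : Site d → 𝔸, (∀ j, j ≤ k → ∀ x ∈ Ω j, IsSelfAdjoint (f x)) → ∀ x, IsSelfAdjoint (g f x))
    (hRbd : ∀ (f : Site d → 𝔸) (m : ℝ), 0 ≤ m → Bd2 L η k Ω f m → Bd2 L η k Ω (f - g (qs (c (q (g f))))) (BR * m))
    (hRreal : ∀ f : Site d → 𝔸, (∀ j, j ≤ k → ∀ x ∈ Ω j, IsSelfAdjoint (f x)) →
      ∀ j, j ≤ k → ∀ x ∈ Ω j, IsSelfAdjoint ((f - g (qs (c (q (g f))))) x))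
    (hDA : Bd2 L η k Ω (fun y => covDivB η U₀ A y) cDA) (hDAsa : ∀ j, j ≤ k → ∀ x ∈ Ω j, IsSelfAdjoint (covDivB η U₀ A x))
    (hA : ∀ j, j ≤ k → ∀ x ∈ Ω j, ∀ μ : Fin d,
      wt L η j * ‖A x μ‖ ≤ cA ∧ wt L η j * ‖conjR (U₀ (x - e μ) μ)⁻¹ (A (x - e μ) μ)‖ ≤ cA)
    (hAsa : ∀ x μ, IsSelfAdjoint (A x μ))
    (h103 : BG * Mc d BR (α₄ / 4 + hE) cA hE₂ cDA ≤ α₄ / 4)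
    (h106 : BG * Kc d BR (α₄ / 4 + hE) cA hE₂ cDA lE₂ (1 + lE) (1 + lE) ≤ 1 / 2)
    -- [3] Prop. 10 inputs for the inverse pair at every small λ′; (1.29) for u₁⁻¹
    (hdom : ∀ lam' : Site d → 𝔸, (∀ x, ‖lam' x‖ ≤ α₄ / 4 + hE) →
      (∀ j, j ≤ k → ∀ p ∈ Eb j, wt L η j * ‖covDerivFwd η U₀ p.2 lam' p.1‖ ≤ α₄ / 4 + hE) →
      ∀ j, j ≤ k → ∀ y ∈ Λs j, ‖util178 L U₀ (gaugeExp lam')⁻¹ u₁⁻¹ j y - 1‖ < 1)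
    (h167 : ∀ lam' : Site d → 𝔸, (∀ x, ‖lam' x‖ ≤ α₄ / 4 + hE) →
      (∀ j, j ≤ k → ∀ p ∈ Eb j, wt L η j * ‖covDerivFwd η U₀ p.2 lam' p.1‖ ≤ α₄ / 4 + hE) →
      Cond167 L U₀ ((gaugeExp lam')⁻¹ * u₁⁻¹) k β η)
    (h129inv : Restr129 L k Λs U₀ u₁⁻¹) (hβ : 0 ≤ β) (hβs : β * (L : ℝ) ^ k * η < 1 / 2) :
    ∃ lam : Site d → 𝔸, (∀ x, IsSelfAdjoint (lam x)) ∧ (∀ x, x ∉ Ω 0 → lam x = 0) ∧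
      (∀ j, j ≤ k → ∀ p ∈ Eb j, ‖lam p.1‖ ≤ α₄ ∧ wt L η j * ‖covDerivFwd η U₀ p.2 lam p.1‖ ≤ α₄) ∧
      (∃ μ : ℕ → Site d → 𝔸, ∀ x ∈ Ω 0,
        covLap η U₀ ((Ω 0).indicator fun y => covDivB η U₀ A y + covLap η U₀ lam y +
          ((conjR (gaugeExp lam y)⁻¹ (covDivB η U₀ A y) - covDivB η U₀ A y) +
            (gAd (covLap η U₀ lam y) (lam y) - covLap η U₀ lam y) + ∑ μ, frakF3 η U₀ lam A y μ)) x = QT L k Λs U₀ μ x) ∧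
      Restr129 L k Λs U₀ (u₁ * gaugeExp lam) := by
  have hL1 : 1 ≤ L := le_trans (by norm_num) hL
  have hC2 : 0 ≤ C2p d := C2p_nonneg d
  have hC2pos : 0 < C2p d := by
    have hC6 : (2 : ℝ) ≤ C6 d := by unfold C6; linarith [one_le_C5 (d := d)]
    unfold C2p Cgen; positivity
  have hα₃ : (0 : ℝ) ≤ 40 * d * cB := by positivity
  have hhE : 0 ≤ hE := by rw [hE_def]; positivity
  have hhE₂ : 0 ≤ hE₂ := by rw [hE₂_def]; positivity
  have hlE : 0 ≤ lE := by rw [lE_def]; positivity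
  have hlE₂ : 0 ≤ lE₂ := by rw [lE₂_def]; positivity
  have hb₁ : 0 < α₄ / 4 + hE := add_pos_of_pos_of_nonneg (by positivity) hhE
  -- `h₀ ≤ ¾α₄` from print's smallness in product form
  have hh₀' : hE ≤ 3 * α₄ / 4 := by
    have h8 := (smallness_prod (d := d) (by positivity) hB hC2pos hsm).1
    have e1 : hE = (C2p d * (40 * d * cB + α₄) * B₀') * α₄ := by rw [hE_def]; ring
    rw [e1]
    calc C2p d * (40 * d * cB + α₄) * B₀' * α₄ ≤ 1 / 8 * α₄ := mul_le_mul_of_nonneg_right h8 hα₄.le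
      _ ≤ 3 * α₄ / 4 := by linarith only [hα₄]
  -- THE solution map D′(u₁⁻¹, −i·) on the ¼α₄-ball (chosen once; Lipschitz; real on Hermitian λ)
  obtain ⟨Dp, hDp, hDpL, hDpR⟩ := exists_Dprime_map hL hη hU₀ H' hα hα3 hα4 hcB hα₄ hB h33 h69 hd hαP hαP3 hαP2 hBu hP hAx h129 hEbT hH0 hH1 hHequiv hQH
    hCequiv hsmall hc₃ hsc hα₃' hs₁ hs₂ hs₃ hs₄ hs₅ hs₆ hs₇ hsm
  -- sizes of D′ and of its differences, multiplied by the (1.92) constants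
  have hbdX : ∀ s : lamSubK η U₀ L k Eb, ‖s‖ ≤ α₄ / 4 → B₀' * ‖Dp (lamOf s)‖ ≤ hE := fun s hs => by
    rw [hE_def]; exact mul_le_mul_of_nonneg_left (hDp s hs).2.1 hB.le
  have hbdX₂ : ∀ s : lamSubK η U₀ L k Eb, ‖s‖ ≤ α₄ / 4 → B₂' * ‖Dp (lamOf s)‖ ≤ hE₂ := fun s hs => by
    rw [hE₂_def]; exact mul_le_mul_of_nonneg_left (hDp s hs).2.1 hB₂
  have hbdL : ∀ s t : lamSubK η U₀ L k Eb, ‖s‖ ≤ α₄ / 4 → ‖t‖ ≤ α₄ / 4 → B₀' * ‖Dp (lamOf s) - Dp (lamOf t)‖ ≤ lE * ‖s - t‖ :=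
    fun s t hs ht => by
    rw [lE_def, mul_assoc]; exact mul_le_mul_of_nonneg_left (hDpL s t hs ht) hB.le
  have hbdL₂ : ∀ s t : lamSubK η U₀ L k Eb, ‖s‖ ≤ α₄ / 4 → ‖t‖ ≤ α₄ / 4 → B₂' * ‖Dp (lamOf s) - Dp (lamOf t)‖ ≤ lE₂ * ‖s - t‖ :=
    fun s t hs ht => by
    rw [lE₂_def, mul_assoc]; exact mul_le_mul_of_nonneg_left (hDpL s t hs ht) hB₂
  have hsubH : ∀ s t : lamSubK η U₀ L k Eb, (-I) • H' (Dp (lamOf s)) - (-I) • H' (Dp (lamOf t)) = (-I) • H' (Dp (lamOf s) - Dp (lamOf t)) :=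
    fun s t => by rw [map_sub, smul_sub]
  -- the eight binders of JOIN-B for `H_c λ := −i·H′D′(u₁⁻¹, −iλ)`
  have hc0 : ∀ s : lamSubK η U₀ L k Eb, ‖s‖ ≤ α₄ / 4 → ∀ x, ‖((-I) • H' (Dp (lamOf s))) x‖ ≤ hE := fun s hs x => by
    rw [Pi.smul_apply, norm_negI_smul]; exact (hH0 _ x).trans (hbdX s hs)
  have hc1 : ∀ s : lamSubK η U₀ L k Eb, ‖s‖ ≤ α₄ / 4 → ∀ j, j ≤ k → ∀ p ∈ Eb j,
      wt L η j * ‖covDerivFwd η U₀ p.2 ((-I) • H' (Dp (lamOf s))) p.1‖ ≤ hE := fun s hs j hj p hp => by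
    rw [covDerivFwd_smul, norm_negI_smul]; exact (hH1 j hj _ p hp).trans (hbdX s hs)
  have hc2 : ∀ s : lamSubK η U₀ L k Eb, ‖s‖ ≤ α₄ / 4 → Bd2 L η k Ω (covLap η U₀ ((-I) • H' (Dp (lamOf s)))) hE₂ :=
    fun s hs j hj x hx => by
    rw [covLap_smul, norm_negI_smul]; exact (hH2 _ j hj x hx).trans (hbdX₂ s hs)
  have hcL0 : ∀ s t : lamSubK η U₀ L k Eb, ‖s‖ ≤ α₄ / 4 → ‖t‖ ≤ α₄ / 4 → ∀ x,
      ‖((-I) • H' (Dp (lamOf s))) x - ((-I) • H' (Dp (lamOf t))) x‖ ≤ lE * ‖s - t‖ := fun s t hs ht x => by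
    rw [← Pi.sub_apply, hsubH, Pi.smul_apply, norm_negI_smul]; exact (hH0 _ x).trans (hbdL s t hs ht)
  have hcL1 : ∀ s t : lamSubK η U₀ L k Eb, ‖s‖ ≤ α₄ / 4 → ‖t‖ ≤ α₄ / 4 → ∀ j, j ≤ k → ∀ p ∈ Eb j,
      wt L η j * ‖covDerivFwd η U₀ p.2 ((-I) • H' (Dp (lamOf s)) - (-I) • H' (Dp (lamOf t))) p.1‖ ≤ lE * ‖s - t‖ :=
    fun s t hs ht j hj p hp => by
    rw [hsubH, covDerivFwd_smul, norm_negI_smul]; exact (hH1 j hj _ p hp).trans (hbdL s t hs ht)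
  have hcL2 : ∀ s t : lamSubK η U₀ L k Eb, ‖s‖ ≤ α₄ / 4 → ‖t‖ ≤ α₄ / 4 →
      Bd2 L η k Ω (covLap η U₀ ((-I) • H' (Dp (lamOf s))) - covLap η U₀ ((-I) • H' (Dp (lamOf t)))) (lE₂ * ‖s - t‖) :=
    fun s t hs ht j hj x hx => by
    rw [Pi.sub_apply, ← covLap_sub, hsubH, covLap_smul, norm_negI_smul]; exact (hH2 _ j hj x hx).trans (hbdL₂ s t hs ht)
  have hcsa : ∀ s : lamSubK η U₀ L k Eb, ‖s‖ ≤ α₄ / 4 → (∀ x, IsSelfAdjoint (lamOf s x)) →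
      ∀ x, IsSelfAdjoint (((-I) • H' (Dp (lamOf s))) x) := fun s hs hsa x => by
    rw [Pi.smul_apply]
    refine isSelfAdjoint_negI_smul_of_skew ?_
    have hX : ∀ p, Dp (lamOf s) p = -star (Dp (lamOf s) p) := fun p => by rw [hDpR s hs hsa p, neg_neg]
    have h2 := congrArg star (hHequiv (Dp (lamOf s)) (Dp (lamOf s)) hX x)
    rw [star_neg, star_star] at h2
    exact h2
  have hcsupp : ∀ s : lamSubK η U₀ L k Eb, ‖s‖ ≤ α₄ / 4 → ∀ x, x ∉ Ω 0 → ((-I) • H' (Dp (lamOf s))) x = 0 := fun s _ x hx => by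
    rw [Pi.smul_apply, hHsupp _ x hx, smul_zero]
  -- (1.79) for the inverse pair from (1.114)
  have h179 : ∀ s : lamSubK η U₀ L k Eb, ‖s‖ ≤ α₄ / 4 → q (lamOf s) = 0 →
      Cond179 L k Λs U₀ (gaugeExp (lamOf s + (-I) • H' (Dp (lamOf s))))⁻¹ u₁⁻¹ := fun s hs hq0 =>
    cond179_of_eq114 H' q hq s (hDp s hs).2.2.2.2 hq0
  -- [3] Prop. 10 inputs at λ′ = λ_s + H_cλ_s
  have hsz : ∀ s : lamSubK η U₀ L k Eb, ‖s‖ ≤ α₄ / 4 → (∀ x, ‖(lamOf s + (-I) • H' (Dp (lamOf s))) x‖ ≤ α₄ / 4 + hE) ∧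
      ∀ j, j ≤ k → ∀ p ∈ Eb j, wt L η j * ‖covDerivFwd η U₀ p.2 (lamOf s + (-I) • H' (Dp (lamOf s))) p.1‖ ≤ α₄ / 4 + hE := by
    intro s hs
    refine ⟨fun x => ?_, fun j hj p hp => ?_⟩
    · rw [Pi.add_apply]
      exact (norm_add_le _ _).trans (add_le_add ((norm_lamOf_le s x).trans hs) (hc0 s hs x))
    · obtain ⟨x, κ⟩ := p
      have h1 : wt L η j * ‖covDerivFwd η U₀ κ (lamOf s) x‖ ≤ ‖s‖ := weight_mul_norm_covDerivFwd_le hη.le s hj hp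
      have h2 : wt L η j * ‖covDerivFwd η U₀ κ ((-I) • H' (Dp (lamOf s))) x‖ ≤ hE := hc1 s hs j hj (x, κ) hp
      have hw : 0 ≤ wt L η j := wt_nonneg L hη.le j
      have h3 : ‖covDerivFwd η U₀ κ (lamOf s + (-I) • H' (Dp (lamOf s))) x‖ ≤
          ‖covDerivFwd η U₀ κ (lamOf s) x‖ + ‖covDerivFwd η U₀ κ ((-I) • H' (Dp (lamOf s))) x‖ := by
        rw [B8LambdaSpaceKLevel.covDerivFwd_add']; exact norm_add_le _ _
      have h4 := mul_le_mul_of_nonneg_left h3 hw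
      show wt L η j * ‖covDerivFwd η U₀ κ (lamOf s + (-I) • H' (Dp (lamOf s))) x‖ ≤ α₄ / 4 + hE
      rw [mul_add] at h4
      linarith only [h4, h1, h2, hs]
  have hdom' : ∀ s : lamSubK η U₀ L k Eb, ‖s‖ ≤ α₄ / 4 → ∀ j, j ≤ k → ∀ y ∈ Λs j,
      ‖util178 L U₀ (gaugeExp (lamOf s + (-I) • H' (Dp (lamOf s))))⁻¹ u₁⁻¹ j y - 1‖ < 1 := fun s hs =>
    hdom _ (hsz s hs).1 (hsz s hs).2
  have h167' : ∀ s : lamSubK η U₀ L k Eb, ‖s‖ ≤ α₄ / 4 →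
      Cond167 L U₀ ((gaugeExp (lamOf s + (-I) • H' (Dp (lamOf s))))⁻¹ * u₁⁻¹) k β η := fun s hs =>
    h167 _ (hsz s hs).1 (hsz s hs).2
  have key2 := hFP_kLevel_of179 (Ω := Ω) (Λs := Λs) (Eb := Eb) (U₀ := U₀) (A := A) (u₁ := u₁) (β := β) hL1 hη hU₀ hEbΩ g Δ q qs Aw c
    g_left g_right c_right hΔ hqs (fun lam => (-I) • H' (Dp lam)) hα₄.le hBG hBR hhE hhE₂ hlE hlE hlE₂ hcA hcA' hcDA ha₁' hb₁' hb₁ hθ hh₀'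
    hh₀' hG hGsupp hGreal hRbd hRreal hc0 hc1 hc2 hcL0 hcL1 hcL2 hcsa hcsupp hDA hDAsa hA hAsa h103 h106 h179 hdom' h167' h129inv hβ hβs
  exact key2

end Join

#print axioms sectE_exists
#print axioms sectE_lipschitz
#print axioms sectE_real
#print axioms cond179_of_eq114
#print axioms exists_Dprime_map
#print axioms hFP_kLevel_of_sectE




end Literature.MathematicalPhysics.QuantumFieldTheory.Balaban1983to89.B8Prop5JoinSectE

end
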